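import Summits.CriticalPhenomena.PercolationContinuityZ3.Theorems.PercNearOneGluingNoHeavyLowerTailSahiTwoLevelVariational

/-!
# The VARIATIONAL ROUTE, companion: the four MONOTONE MOVES of the two-level TOP form `T⁺`

Support file of the one-cut programme (crux `NoHeavyLowerTail`, stmt-CriticalPhenomena-4575; master-family line P2, seat `prim-masterthm-p2`
gen 20; memo `run/shared/lean/prim/prim-masterthm/FROM-prim-masterthm-p2-g20-VARIATIONAL-ROUTE.md`).  No definition, no sorry, standard axioms.

By the compact form (`SahiTwoLevelVariational.topForm_eq_compact`) `T⁺(G,H)` is affine in each of the six events separately.  This file records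
the two INCREMENT identities (slot `0` designated; any slot by `topForm_rot`) and the four sign consequences:
* `topForm_bottom_increment`: for `A` disjoint from `H₀`,
  `T⁺(G; H₀ ∪ A, H₁, H₂) − T⁺(G; H₀, H₁, H₂) = 2μ(A ∩ H₁ ∩ H₂) − μ(G₁)μ(A ∩ H₂) − μ(G₂)μ(A ∩ H₁) − μ(A)·Cov(G₁,G₂)`;
* `topForm_top_increment`: for `A` disjoint from `G₀`,
  `T⁺(G₀ ∪ A, G₁, G₂; H) − T⁺(G₀, G₁, G₂; H) = 2μ(A ∩ G₁ ∩ G₂) − μ(A)μ(H₁H₂) − μ(H₁)(μ(A ∩ G₂) − μ(A)μ(G₂)) − μ(H₂)(μ(A ∩ G₁) − μ(A)μ(G₁)) − μ(A)μ(G₁)μ(G₂)`;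
* **(B+)** `topForm_bottom_union_le`: adding to `H₀` a set avoiding `H₁ ∩ H₂` does not increase `T⁺` (Harris for `G₁, G₂`);
* **(B−)** `topForm_bottom_sdiff_le`: removing from `H₀` a part of `H₁ ∩ H₂` does not increase `T⁺`;
* **(T+)** `topForm_top_union_le`: adding to `G₀` a set avoiding `G₁ ∩ G₂` does not increase `T⁺` (Harris for `H₁, H₂`, `H_i ⊆ G_i`);
* **(T−)** `topForm_top_sdiff_le`: removing from `G₀` a part of `G₁ ∩ G₂` does not increase `T⁺`.
Consequently a minimiser of `T⁺` over nested pairs of increasing triples has: bottoms generated by their points outside the other two bottoms and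
saturated outside them, tops generated by the bottom and the points outside the other two tops and saturated outside them — the first-order
conditions behind `SahiTwoLevelVariational.SolvedFaceDescent` (census: memo §3).  HONEST LABEL: identities and one-sided inequalities only. [this work]
-/

noncomputable section

open scoped Classical

namespace Summit.CriticalPhenomena.PercolationContinuityZ3.Theorems

namespace SahiTwoLevelVariational

open Finset Function MeasureTheory
open Literature.Combinatorics.Sahi2008
open Literature.Probability.LatticeModels (prodBernoulli prodBernoulli_harris sahiE3 sahiE3_def)

variable {κ : Type} [Fintype κ]


/-- Additivity of `(prodBernoulli q).real` over a disjoint union (finite cube: every event is measurable). [folklore] -/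
theorem real_union_of_disjoint (q : κ → unitInterval) {s t : Set (Set κ)} (h : Disjoint s t) :
    (prodBernoulli q).real (s ∪ t) = (prodBernoulli q).real s + (prodBernoulli q).real t :=
  measureReal_union h MeasurableSet.of_discrete

/-- **BOTTOM INCREMENT** (slot `0`): for `A` disjoint from `H₀`,
`T⁺(G; H₀ ∪ A, H₁, H₂) − T⁺(G; H₀, H₁, H₂) = 2μ(A ∩ H₁ ∩ H₂) − μ(G₁)μ(A ∩ H₂) − μ(G₂)μ(A ∩ H₁) − μ(A)·Cov(G₁,G₂)`:
the bottom coefficient of a point is `≤ 0` off `H₁ ∩ H₂` and `≥ 0` on it. [this work] -/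
theorem topForm_bottom_increment (q : κ → unitInterval) (G : Fin 3 → Set (Set κ)) (H₀ A H₁ H₂ : Set (Set κ))
    (hdisj : Disjoint H₀ A) :
    topForm q G ![H₀ ∪ A, H₁, H₂] - topForm q G ![H₀, H₁, H₂] =
      2 * (prodBernoulli q).real (A ∩ H₁ ∩ H₂) - (prodBernoulli q).real (G 1) * (prodBernoulli q).real (A ∩ H₂)
      - (prodBernoulli q).real (G 2) * (prodBernoulli q).real (A ∩ H₁)
      - (prodBernoulli q).real A * ((prodBernoulli q).real (G 1 ∩ G 2) - (prodBernoulli q).real (G 1) * (prodBernoulli q).real (G 2)) := by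
  have e1 : (prodBernoulli q).real ((H₀ ∪ A) ∩ H₁ ∩ H₂) = (prodBernoulli q).real (H₀ ∩ H₁ ∩ H₂) + (prodBernoulli q).real (A ∩ H₁ ∩ H₂) := by
    rw [Set.union_inter_distrib_right, Set.union_inter_distrib_right]
    exact real_union_of_disjoint q ((hdisj.mono Set.inter_subset_left Set.inter_subset_left).mono Set.inter_subset_left Set.inter_subset_left)
  have e2 : (prodBernoulli q).real ((H₀ ∪ A) ∩ H₂) = (prodBernoulli q).real (H₀ ∩ H₂) + (prodBernoulli q).real (A ∩ H₂) := by
    rw [Set.union_inter_distrib_right]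
    exact real_union_of_disjoint q (hdisj.mono Set.inter_subset_left Set.inter_subset_left)
  have e3 : (prodBernoulli q).real ((H₀ ∪ A) ∩ H₁) = (prodBernoulli q).real (H₀ ∩ H₁) + (prodBernoulli q).real (A ∩ H₁) := by
    rw [Set.union_inter_distrib_right]
    exact real_union_of_disjoint q (hdisj.mono Set.inter_subset_left Set.inter_subset_left)
  have e4 : (prodBernoulli q).real (H₀ ∪ A) = (prodBernoulli q).real H₀ + (prodBernoulli q).real A := real_union_of_disjoint q hdisj
  rw [topForm_eq_compact, topForm_eq_compact]
  simp only [Matrix.cons_val_zero, Matrix.cons_val_one, Matrix.cons_val_two, Matrix.head_cons, Matrix.tail_cons]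
  rw [e1, e2, e3, e4]
  ring

/-- **TOP INCREMENT** (slot `0`): for `A` disjoint from `G₀`,
`T⁺(G₀ ∪ A, G₁, G₂; H) − T⁺(G₀, G₁, G₂; H) = 2μ(A ∩ G₁ ∩ G₂) − μ(A)μ(H₁ ∩ H₂) − μ(H₁)(μ(A ∩ G₂) − μ(A)μ(G₂))
 − μ(H₂)(μ(A ∩ G₁) − μ(A)μ(G₁)) − μ(A)μ(G₁)μ(G₂)`: the top coefficient of a point is `≤ 0` off `G₁ ∩ G₂` and `≥ 0` on it. [this work] -/
theorem topForm_top_increment (q : κ → unitInterval) (H : Fin 3 → Set (Set κ)) (G₀ A G₁ G₂ : Set (Set κ))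
    (hdisj : Disjoint G₀ A) :
    topForm q ![G₀ ∪ A, G₁, G₂] H - topForm q ![G₀, G₁, G₂] H =
      2 * (prodBernoulli q).real (A ∩ G₁ ∩ G₂) - (prodBernoulli q).real A * (prodBernoulli q).real (H 1 ∩ H 2)
      - (prodBernoulli q).real (H 1) * ((prodBernoulli q).real (A ∩ G₂) - (prodBernoulli q).real A * (prodBernoulli q).real G₂)
      - (prodBernoulli q).real (H 2) * ((prodBernoulli q).real (A ∩ G₁) - (prodBernoulli q).real A * (prodBernoulli q).real G₁)
      - (prodBernoulli q).real A * (prodBernoulli q).real G₁ * (prodBernoulli q).real G₂ := by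
  have e1 : (prodBernoulli q).real ((G₀ ∪ A) ∩ G₁ ∩ G₂) = (prodBernoulli q).real (G₀ ∩ G₁ ∩ G₂) + (prodBernoulli q).real (A ∩ G₁ ∩ G₂) := by
    rw [Set.union_inter_distrib_right, Set.union_inter_distrib_right]
    exact real_union_of_disjoint q ((hdisj.mono Set.inter_subset_left Set.inter_subset_left).mono Set.inter_subset_left Set.inter_subset_left)
  have e2 : (prodBernoulli q).real ((G₀ ∪ A) ∩ G₂) = (prodBernoulli q).real (G₀ ∩ G₂) + (prodBernoulli q).real (A ∩ G₂) := by
    rw [Set.union_inter_distrib_right]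
    exact real_union_of_disjoint q (hdisj.mono Set.inter_subset_left Set.inter_subset_left)
  have e3 : (prodBernoulli q).real ((G₀ ∪ A) ∩ G₁) = (prodBernoulli q).real (G₀ ∩ G₁) + (prodBernoulli q).real (A ∩ G₁) := by
    rw [Set.union_inter_distrib_right]
    exact real_union_of_disjoint q (hdisj.mono Set.inter_subset_left Set.inter_subset_left)
  have e4 : (prodBernoulli q).real (G₀ ∪ A) = (prodBernoulli q).real G₀ + (prodBernoulli q).real A := real_union_of_disjoint q hdisj
  rw [topForm_eq_compact, topForm_eq_compact]
  simp only [Matrix.cons_val_zero, Matrix.cons_val_one, Matrix.cons_val_two, Matrix.head_cons, Matrix.tail_cons]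
  rw [e1, e2, e3, e4]
  ring

/-- **MOVE (B+)**: adding to the bottom `H₀` a set `A` (disjoint from `H₀`) that avoids `H₁ ∩ H₂` does not increase `T⁺`
(top events `G₁, G₂` increasing: Harris). [this work] -/
theorem topForm_bottom_union_le (q : κ → unitInterval) (G : Fin 3 → Set (Set κ)) (H₀ A H₁ H₂ : Set (Set κ))
    (hG1 : IsUpperSet (G 1)) (hG2 : IsUpperSet (G 2)) (hdisj : Disjoint H₀ A) (hA : A ∩ H₁ ∩ H₂ = ∅) :
    topForm q G ![H₀ ∪ A, H₁, H₂] ≤ topForm q G ![H₀, H₁, H₂] := by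
  have h := topForm_bottom_increment q G H₀ A H₁ H₂ hdisj
  rw [hA, measureReal_empty] at h
  have hcov : 0 ≤ (prodBernoulli q).real (G 1 ∩ G 2) - (prodBernoulli q).real (G 1) * (prodBernoulli q).real (G 2) :=
    sub_nonneg.2 (prodBernoulli_harris q hG1 hG2 MeasurableSet.of_discrete MeasurableSet.of_discrete)
  have hA0 : 0 ≤ (prodBernoulli q).real A := measureReal_nonneg
  have h1 : 0 ≤ (prodBernoulli q).real (G 1) := measureReal_nonneg
  have h2 : 0 ≤ (prodBernoulli q).real (G 2) := measureReal_nonneg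
  have h3 : 0 ≤ (prodBernoulli q).real (A ∩ H₂) := measureReal_nonneg
  have h4 : 0 ≤ (prodBernoulli q).real (A ∩ H₁) := measureReal_nonneg
  nlinarith [mul_nonneg h1 h3, mul_nonneg h2 h4, mul_nonneg hA0 hcov]

/-- **MOVE (B−)**: removing from the bottom `H₀` a part `K ⊆ H₀ ∩ H₁ ∩ H₂` does not increase `T⁺`. [this work] -/
theorem topForm_bottom_sdiff_le (q : κ → unitInterval) (G : Fin 3 → Set (Set κ)) (H₀ K H₁ H₂ : Set (Set κ))
    (hK : K ⊆ H₀ ∩ H₁ ∩ H₂) :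
    topForm q G ![H₀ \ K, H₁, H₂] ≤ topForm q G ![H₀, H₁, H₂] := by
  have hKH : K ⊆ H₀ := fun ω hω => (hK hω).1.1
  have hsplit : H₀ \ K ∪ K = H₀ := Set.sdiff_union_of_subset hKH
  have h := topForm_bottom_increment q G (H₀ \ K) K H₁ H₂ Set.disjoint_sdiff_left
  rw [hsplit] at h
  have hK12 : K ∩ H₁ ∩ H₂ = K := by
    ext ω; simp only [Set.mem_inter_iff]
    exact ⟨fun h => h.1.1, fun h => ⟨⟨h, (hK h).1.2⟩, (hK h).2⟩⟩
  have hK2 : K ∩ H₂ = K := Set.inter_eq_left.2 fun ω hω => (hK hω).2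
  have hK1 : K ∩ H₁ = K := Set.inter_eq_left.2 fun ω hω => (hK hω).1.2
  rw [hK12, hK2, hK1] at h
  have hg1 : (prodBernoulli q).real (G 1) ≤ 1 := measureReal_le_one
  have hg2 : (prodBernoulli q).real (G 2) ≤ 1 := measureReal_le_one
  have hg12 : (prodBernoulli q).real (G 1 ∩ G 2) ≤ (prodBernoulli q).real (G 1) := measureReal_mono Set.inter_subset_left
  have hKn : 0 ≤ (prodBernoulli q).real K := measureReal_nonneg
  have h1n : 0 ≤ 1 - (prodBernoulli q).real (G 1) := by linarith
  have h2n : 0 ≤ 2 - (prodBernoulli q).real (G 2) := by linarith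
  -- coefficient `2 − g₁ − g₂ − Cov(G₁,G₂) ≥ (1 − g₁)(2 − g₂) ≥ 0`
  nlinarith [mul_nonneg hKn (mul_nonneg h1n h2n), mul_nonneg hKn (sub_nonneg.2 hg12)]

/-- **MOVE (T+)**: adding to the top `G₀` a set `A` (disjoint from `G₀`) that avoids `G₁ ∩ G₂` does not increase `T⁺`
(bottoms `H₁ ⊆ G₁`, `H₂ ⊆ G₂` increasing: Harris). [this work] -/
theorem topForm_top_union_le (q : κ → unitInterval) (H : Fin 3 → Set (Set κ)) (G₀ A G₁ G₂ : Set (Set κ))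
    (hH1 : IsUpperSet (H 1)) (hH2 : IsUpperSet (H 2)) (hH1G : H 1 ⊆ G₁) (hH2G : H 2 ⊆ G₂)
    (hdisj : Disjoint G₀ A) (hA : A ∩ G₁ ∩ G₂ = ∅) :
    topForm q ![G₀ ∪ A, G₁, G₂] H ≤ topForm q ![G₀, G₁, G₂] H := by
  have h := topForm_top_increment q H G₀ A G₁ G₂ hdisj
  rw [hA, measureReal_empty] at h
  have hcov : 0 ≤ (prodBernoulli q).real (H 1 ∩ H 2) - (prodBernoulli q).real (H 1) * (prodBernoulli q).real (H 2) :=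
    sub_nonneg.2 (prodBernoulli_harris q hH1 hH2 MeasurableSet.of_discrete MeasurableSet.of_discrete)
  have hA0 : 0 ≤ (prodBernoulli q).real A := measureReal_nonneg
  have h1 : 0 ≤ (prodBernoulli q).real (H 1) := measureReal_nonneg
  have h2 : 0 ≤ (prodBernoulli q).real (H 2) := measureReal_nonneg
  have h3 : 0 ≤ (prodBernoulli q).real (A ∩ G₂) := measureReal_nonneg
  have h4 : 0 ≤ (prodBernoulli q).real (A ∩ G₁) := measureReal_nonneg
  have hd1 : 0 ≤ (prodBernoulli q).real G₁ - (prodBernoulli q).real (H 1) := sub_nonneg.2 (measureReal_mono hH1G)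
  have hd2 : 0 ≤ (prodBernoulli q).real G₂ - (prodBernoulli q).real (H 2) := sub_nonneg.2 (measureReal_mono hH2G)
  -- coefficient of `μ(A)`: `−(Cov(H₁,H₂) + (g₁ − h₁)(g₂ − h₂))`, plus `−h₁ μ(A ∩ G₂) − h₂ μ(A ∩ G₁)`
  nlinarith [mul_nonneg hA0 hcov, mul_nonneg hA0 (mul_nonneg hd1 hd2), mul_nonneg h1 h3, mul_nonneg h2 h4]

/-- **MOVE (T−)**: removing from the top `G₀` a part `K ⊆ G₀ ∩ G₁ ∩ G₂` does not increase `T⁺` (bottoms `H₁ ⊆ G₁`, `H₂ ⊆ G₂`;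
for admissibility one also wants `K ∩ H₀ = ∅`, not needed for the inequality). [this work] -/
theorem topForm_top_sdiff_le (q : κ → unitInterval) (H : Fin 3 → Set (Set κ)) (G₀ K G₁ G₂ : Set (Set κ))
    (hH1G : H 1 ⊆ G₁) (hH2G : H 2 ⊆ G₂) (hK : K ⊆ G₀ ∩ G₁ ∩ G₂) :
    topForm q ![G₀ \ K, G₁, G₂] H ≤ topForm q ![G₀, G₁, G₂] H := by
  have hKG : K ⊆ G₀ := fun ω hω => (hK hω).1.1
  have hsplit : G₀ \ K ∪ K = G₀ := Set.sdiff_union_of_subset hKG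
  have h := topForm_top_increment q H (G₀ \ K) K G₁ G₂ Set.disjoint_sdiff_left
  rw [hsplit] at h
  have hK12 : K ∩ G₁ ∩ G₂ = K := by
    ext ω; simp only [Set.mem_inter_iff]
    exact ⟨fun h => h.1.1, fun h => ⟨⟨h, (hK h).1.2⟩, (hK h).2⟩⟩
  have hK2 : K ∩ G₂ = K := Set.inter_eq_left.2 fun ω hω => (hK hω).2
  have hK1 : K ∩ G₁ = K := Set.inter_eq_left.2 fun ω hω => (hK hω).1.2
  rw [hK12, hK2, hK1] at h
  have hg1 : (prodBernoulli q).real G₁ ≤ 1 := measureReal_le_one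
  have hg2 : (prodBernoulli q).real G₂ ≤ 1 := measureReal_le_one
  have hh12 : (prodBernoulli q).real (H 1 ∩ H 2) ≤ 1 := measureReal_le_one
  have hKn : 0 ≤ (prodBernoulli q).real K := measureReal_nonneg
  have hd1 : 0 ≤ (prodBernoulli q).real G₁ - (prodBernoulli q).real (H 1) := sub_nonneg.2 (measureReal_mono hH1G)
  have hd2 : 0 ≤ (prodBernoulli q).real G₂ - (prodBernoulli q).real (H 2) := sub_nonneg.2 (measureReal_mono hH2G)
  have h1n : 0 ≤ 1 - (prodBernoulli q).real G₁ := by linarith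
  have h2n : 0 ≤ 1 - (prodBernoulli q).real G₂ := by linarith
  have hh2 : 0 ≤ 1 - (prodBernoulli q).real (H 2) := by linarith [hd2]
  -- coefficient `(1−h₁)(1−h₂) + 1 − μ(H₁H₂) − (g₁−h₁)(g₂−h₂) = (1−g₁)(1−h₂) + (g₁−h₁)(1−g₂) + 1 − μ(H₁H₂) ≥ 0`
  nlinarith [mul_nonneg hKn (mul_nonneg h1n hh2), mul_nonneg hKn (mul_nonneg hd1 h2n), mul_nonneg hKn (sub_nonneg.2 hh12)]


/-! ### Appended (gen 20, later): the point-accounting identity, the exclusive-shell class, the empty slot -/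

omit [Fintype κ] in
/-- **POINT-ACCOUNTING IDENTITY** (expansion of `T⁺` around the TOP triple; any two triples of events, ring identity in the moments):
`T⁺(G,H) = 2E_3(G) + Σ_i (μ G_i − μ H_i)·Cov(G_j,G_k) + Σ_i μ(G_i)·(μ(G_jG_k) − μ(H_jH_k)) − 2(μ(G₀G₁G₂) − μ(H₀H₁H₂))`.
For a nested pair of increasing triples every term except the last is `≥ 0` (given `E_3(G) ≥ 0`); the last counts the points of `G₀G₁G₂ ∖ H₀H₁H₂`
(the COSTLY shell points) twice. [this work] -/
theorem topForm_eq_accounting (q : κ → unitInterval) (G H : Fin 3 → Set (Set κ)) :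
    topForm q G H =
      2 * sahiE3 (prodBernoulli q) (G 0) (G 1) (G 2)
      + (((prodBernoulli q).real (G 0) - (prodBernoulli q).real (H 0))
          * ((prodBernoulli q).real (G 1 ∩ G 2) - (prodBernoulli q).real (G 1) * (prodBernoulli q).real (G 2))
        + ((prodBernoulli q).real (G 1) - (prodBernoulli q).real (H 1))
          * ((prodBernoulli q).real (G 0 ∩ G 2) - (prodBernoulli q).real (G 0) * (prodBernoulli q).real (G 2))
        + ((prodBernoulli q).real (G 2) - (prodBernoulli q).real (H 2))
          * ((prodBernoulli q).real (G 0 ∩ G 1) - (prodBernoulli q).real (G 0) * (prodBernoulli q).real (G 1)))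
      + ((prodBernoulli q).real (G 0) * ((prodBernoulli q).real (G 1 ∩ G 2) - (prodBernoulli q).real (H 1 ∩ H 2))
        + (prodBernoulli q).real (G 1) * ((prodBernoulli q).real (G 0 ∩ G 2) - (prodBernoulli q).real (H 0 ∩ H 2))
        + (prodBernoulli q).real (G 2) * ((prodBernoulli q).real (G 0 ∩ G 1) - (prodBernoulli q).real (H 0 ∩ H 1)))
      - 2 * ((prodBernoulli q).real (G 0 ∩ G 1 ∩ G 2) - (prodBernoulli q).real (H 0 ∩ H 1 ∩ H 2)) := by
  rw [topForm_eq_compact, sahiE3_def]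
  ring

omit [Fintype κ] in
/-- **THE EXCLUSIVE-SHELL CLASS**: if every removed part `G_i ∖ H_i` avoids both other tops (equivalently `G_i ∩ G_j ⊆ H_i` for `i ≠ j`; the
hub / independent-tops equality families of the two-level law live here), then the pairwise and triple intersections of the tops and of the
bottoms coincide and `T⁺(G,H) = 2E_3(G) + Σ_i (μ G_i − μ H_i)·Cov(G_j,G_k)`. [this work] -/
theorem topForm_eq_of_exclusive (q : κ → unitInterval) (G H : Fin 3 → Set (Set κ)) (hHG : ∀ i, H i ⊆ G i)
    (h01 : G 0 ∩ G 1 ⊆ H 0) (h02 : G 0 ∩ G 2 ⊆ H 0) (h10 : G 1 ∩ G 0 ⊆ H 1) (h12 : G 1 ∩ G 2 ⊆ H 1)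
    (h20 : G 2 ∩ G 0 ⊆ H 2) (h21 : G 2 ∩ G 1 ⊆ H 2) :
    topForm q G H =
      2 * sahiE3 (prodBernoulli q) (G 0) (G 1) (G 2)
      + (((prodBernoulli q).real (G 0) - (prodBernoulli q).real (H 0))
          * ((prodBernoulli q).real (G 1 ∩ G 2) - (prodBernoulli q).real (G 1) * (prodBernoulli q).real (G 2))
        + ((prodBernoulli q).real (G 1) - (prodBernoulli q).real (H 1))
          * ((prodBernoulli q).real (G 0 ∩ G 2) - (prodBernoulli q).real (G 0) * (prodBernoulli q).real (G 2))
        + ((prodBernoulli q).real (G 2) - (prodBernoulli q).real (H 2))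
          * ((prodBernoulli q).real (G 0 ∩ G 1) - (prodBernoulli q).real (G 0) * (prodBernoulli q).real (G 1))) := by
  have e12 : H 1 ∩ H 2 = G 1 ∩ G 2 := Set.Subset.antisymm (Set.inter_subset_inter (hHG 1) (hHG 2))
    (fun ω hω => ⟨h12 hω, h21 ⟨hω.2, hω.1⟩⟩)
  have e02 : H 0 ∩ H 2 = G 0 ∩ G 2 := Set.Subset.antisymm (Set.inter_subset_inter (hHG 0) (hHG 2))
    (fun ω hω => ⟨h02 hω, h20 ⟨hω.2, hω.1⟩⟩)
  have e01 : H 0 ∩ H 1 = G 0 ∩ G 1 := Set.Subset.antisymm (Set.inter_subset_inter (hHG 0) (hHG 1))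
    (fun ω hω => ⟨h01 hω, h10 ⟨hω.2, hω.1⟩⟩)
  have e012 : H 0 ∩ H 1 ∩ H 2 = G 0 ∩ G 1 ∩ G 2 :=
    Set.Subset.antisymm (Set.inter_subset_inter (Set.inter_subset_inter (hHG 0) (hHG 1)) (hHG 2))
      (fun ω hω => ⟨⟨h01 hω.1, h12 ⟨hω.1.2, hω.2⟩⟩, h20 ⟨hω.2, hω.1.1⟩⟩)
  rw [topForm_eq_accounting, e012, e12, e02, e01]
  ring

/-- On the exclusive-shell class the top law holds with slack: `T⁺ ≥ 2E_3(G)` (Harris for the three pairs of tops). [this work] -/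
theorem two_mul_sahiE3_le_topForm_of_exclusive (q : κ → unitInterval) (G H : Fin 3 → Set (Set κ))
    (hG : ∀ i, IsUpperSet (G i)) (hHG : ∀ i, H i ⊆ G i)
    (h01 : G 0 ∩ G 1 ⊆ H 0) (h02 : G 0 ∩ G 2 ⊆ H 0) (h10 : G 1 ∩ G 0 ⊆ H 1) (h12 : G 1 ∩ G 2 ⊆ H 1)
    (h20 : G 2 ∩ G 0 ⊆ H 2) (h21 : G 2 ∩ G 1 ⊆ H 2) :
    2 * sahiE3 (prodBernoulli q) (G 0) (G 1) (G 2) ≤ topForm q G H := by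
  rw [topForm_eq_of_exclusive q G H hHG h01 h02 h10 h12 h20 h21]
  have c12 : 0 ≤ (prodBernoulli q).real (G 1 ∩ G 2) - (prodBernoulli q).real (G 1) * (prodBernoulli q).real (G 2) :=
    sub_nonneg.2 (prodBernoulli_harris q (hG 1) (hG 2) MeasurableSet.of_discrete MeasurableSet.of_discrete)
  have c02 : 0 ≤ (prodBernoulli q).real (G 0 ∩ G 2) - (prodBernoulli q).real (G 0) * (prodBernoulli q).real (G 2) :=
    sub_nonneg.2 (prodBernoulli_harris q (hG 0) (hG 2) MeasurableSet.of_discrete MeasurableSet.of_discrete)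
  have c01 : 0 ≤ (prodBernoulli q).real (G 0 ∩ G 1) - (prodBernoulli q).real (G 0) * (prodBernoulli q).real (G 1) :=
    sub_nonneg.2 (prodBernoulli_harris q (hG 0) (hG 1) MeasurableSet.of_discrete MeasurableSet.of_discrete)
  have d0 : 0 ≤ (prodBernoulli q).real (G 0) - (prodBernoulli q).real (H 0) := sub_nonneg.2 (measureReal_mono (hHG 0))
  have d1 : 0 ≤ (prodBernoulli q).real (G 1) - (prodBernoulli q).real (H 1) := sub_nonneg.2 (measureReal_mono (hHG 1))
  have d2 : 0 ≤ (prodBernoulli q).real (G 2) - (prodBernoulli q).real (H 2) := sub_nonneg.2 (measureReal_mono (hHG 2))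
  nlinarith [mul_nonneg d0 c12, mul_nonneg d1 c02, mul_nonneg d2 c01]

omit [Fintype κ] in
/-- **AN EMPTY SLOT KILLS `T⁺`**: with `G₀ = H₀ = ∅` the top form vanishes (every term of the compact form carries a factor `μ(G₀)`, `μ(H₀)`,
`μ(G₀G₁G₂)` or `μ(H₀H₁H₂)`).  Consequently a nested pair that no admissible same-slot replacement improves has `T⁺ ≤ 0`: the stable pairs of the
variational route are exactly the ZEROS of the top law wherever the law holds. [this work] -/
theorem topForm_emptySlot (q : κ → unitInterval) (G₁ G₂ H₁ H₂ : Set (Set κ)) :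
    topForm q ![∅, G₁, G₂] ![∅, H₁, H₂] = 0 := by
  rw [topForm_eq_compact]
  simp only [Matrix.cons_val_zero, Matrix.cons_val_one, Matrix.cons_val_two, Matrix.head_cons, Matrix.tail_cons,
    Set.empty_inter, measureReal_empty]
  ring

end SahiTwoLevelVariational

end Summit.CriticalPhenomena.PercolationContinuityZ3.Theorems
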